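/-
Copyright (c) 2026 the pub-hodgecm-mathlib formalisation cell (harness21).  Prover seat hodgecm-mathlib-K2Liu-p11 (g2), Track B «K2-LIT»,
#184♮ = hLiu418 = `stmt-HodgeConjecture-24832`; organ S2, LEAD F0P6-plan (g14) RULING M-158g road (γ): the multi-place compact-picture carrier, INSTANCE leaf
(definition lane; K2Liu-p14 (g2) CHECK (b) 13:46Z: items (i) and (iii); (ii) = K2Liu-p10's `K2LiuU22CompactPictureSlotHom`).
-/
import Summits.HodgeConjecture.HodgeConjecture.Theorems.K2LiuPolynomialLocalizationDerivationDefs   -- ★∕📤 generic layer (this seat): `pdAway`, `invAway`, `evalAway`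
import Mathlib.LinearAlgebra.Matrix.Determinant.Basic
import Mathlib.Algebra.BigOperators.Group.Finset.Basic
import HarnessLib

/-!
# Crux `HLiu418`, road (γ): THE MULTI-PLACE COMPACT-PICTURE CARRIER `ℂ[u_w : w ∈ ι][∏_w D_w⁻¹]` with per-place data `(∂_w, u_w, D_w⁻¹)` and point evaluations

Cell `hodgecm-mathlib`, crux item hLiu418 = `stmt-HodgeConjecture-24832` (helper lane `--supports`, count-neutral; DEFINITIONS + interface lemmas).

For a finite set of places `ι`: `MCarrier ι := Localization.Away (∏_w det_w)` over `MvPolynomial ((Fin 2 × Fin 2) × ι) ℂ`, with, for each place `w`, the coordinate matrix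
`uM ι w`, the inverse determinant `DinvM ι w`, the formal partials `dM ι w i j` — satisfying ★ DEFS's one-place interface AT `w` (`dM_uM_same` = `hd`, `det_uM_mul_DinvM` = `hD`,
`dM_DinvM_same` = ★ `pd_dInv`'s shape) and the CROSS-PLACE VANISHING `dM_uM_of_ne`, `dM_det_uM_of_ne`, `dM_DinvM_of_ne` (the «frozen factor» hypotheses of
★ `K2LiuU22OperatorsFrozenFactor`) — and the point evaluations `evM ι v hv : MCarrier ι →ₐ[ℂ] ℂ` at `v : ι → GL₂(ℂ)`-points (`evM_uM`, `evM_det_uM`, `evM_DinvM`;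
multiplicativity over slots is `map_prod`).  So ★ `pOp (dM ι w) (uM ι w) (DinvM ι w) p a b` etc. are the slot operators of ★ (J-ii) `K2LiuSlotwiseSubmoduleInduction` on `R := MCarrier ι`.
References: [LeeZhu1998, §5 p. 5032]; [KashiwaraVergne1978, §II.5].
HONEST LABEL: HC_CM is proved only modulo the 7 printed citations (2 remaining named inputs: hLiu418 = stmt-HodgeConjecture-24832,
h413 = stmt-HodgeConjecture-24833) until rung 0 closes; count-neutral helper, closes no socket.
-/

set_option autoImplicit false
set_option linter.dupNamespace false

noncomputable section

open MvPolynomial Matrix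
open Summit.HodgeConjecture.HodgeConjecture.Cruxes.HLiu418.K2LiuPolynomialLocalizationDerivationDefs

namespace Summit.HodgeConjecture.HodgeConjecture.Cruxes.HLiu418.K2LiuU22MultiPlaceCarrierDefs

variable (ι : Type) [Fintype ι]

/-! ## §1  The carrier and the per-place coordinates -/

/-- The determinant polynomial of the place `w`: `X_{00,w} X_{11,w} − X_{01,w} X_{10,w}`. [LeeZhu1998, §5] -/
def detPolyAt (w : ι) : MvPolynomial ((Fin 2 × Fin 2) × ι) ℂ :=
  X ((0, 0), w) * X ((1, 1), w) - X ((0, 1), w) * X ((1, 0), w)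

/-- The localising polynomial `∏_w det_w`. [LeeZhu1998, §5] -/
def multiDet : MvPolynomial ((Fin 2 × Fin 2) × ι) ℂ :=
  ∏ w, detPolyAt ι w

/-- **THE MULTI-PLACE CARRIER `ℂ[u_w : w][∏_w D_w⁻¹]`**. [LeeZhu1998, §5] [KashiwaraVergne1978, §II.5] -/
abbrev MCarrier : Type :=
  Localization.Away (multiDet ι)

/-- The coordinate matrix of the place `w`: `(uM ι w) i j = X_{ij,w}`. [LeeZhu1998, §5] -/
def uM (w : ι) : Matrix (Fin 2) (Fin 2) (MCarrier ι) :=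
  fun i j => algebraMap (MvPolynomial ((Fin 2 × Fin 2) × ι) ℂ) (MCarrier ι) (X ((i, j), w))

/-- unfolding. [folklore] -/
theorem uM_apply (w : ι) (i j : Fin 2) : uM ι w i j = algebraMap (MvPolynomial ((Fin 2 × Fin 2) × ι) ℂ) (MCarrier ι) (X ((i, j), w)) :=
  rfl

/-- `det (uM ι w)` is the image of `det_w`. [folklore] -/
theorem det_uM (w : ι) : (uM ι w).det = algebraMap (MvPolynomial ((Fin 2 × Fin 2) × ι) ℂ) (MCarrier ι) (detPolyAt ι w) := by
  rw [Matrix.det_fin_two]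
  simp only [detPolyAt, map_sub, map_mul, uM_apply]

section Dec

variable [DecidableEq ι]

/-- **`D_w⁻¹`**: `(∏_{w′ ≠ w} det_{w′}) · (∏_{w′} det_{w′})⁻¹`. [LeeZhu1998, §5] -/
def DinvM (w : ι) : MCarrier ι :=
  algebraMap (MvPolynomial ((Fin 2 × Fin 2) × ι) ℂ) (MCarrier ι) (∏ w' ∈ Finset.univ.erase w, detPolyAt ι w') * invAway (multiDet ι)

/-- **`det(u_w) · D_w⁻¹ = 1`** — ★ DEFS's interface law `hD` at the place `w`. [LeeZhu1998, §5] -/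
theorem det_uM_mul_DinvM (w : ι) : (uM ι w).det * DinvM ι w = 1 := by
  rw [det_uM, DinvM, ← mul_assoc, ← map_mul, Finset.mul_prod_erase Finset.univ (detPolyAt ι) (Finset.mem_univ w)]
  exact algebraMap_mul_invAway (multiDet ι)

/-- `det(u_w)` is a unit. [folklore] -/
theorem isUnit_det_uM (w : ι) : IsUnit (uM ι w).det :=
  isUnit_iff_exists_inv.2 ⟨DinvM ι w, det_uM_mul_DinvM ι w⟩

/-! ## §2  The per-place formal partials -/

/-- **`∂_{ij,w}`** — the formal partial derivative in the coordinate `X_{ij,w}` on the multi-place carrier. [KashiwaraVergne1978, §II.5] -/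
def dM (w : ι) (i j : Fin 2) : Derivation ℂ (MCarrier ι) (MCarrier ι) :=
  pdAway (multiDet ι) ((i, j), w)

/-- `∂_{ij,w}` extends `pderiv ((i,j),w)`. [KashiwaraVergne1978, §II.5] -/
theorem dM_algebraMap (w : ι) (i j : Fin 2) (P : MvPolynomial ((Fin 2 × Fin 2) × ι) ℂ) :
    dM ι w i j (algebraMap (MvPolynomial ((Fin 2 × Fin 2) × ι) ℂ) (MCarrier ι) P) =
      algebraMap (MvPolynomial ((Fin 2 × Fin 2) × ι) ℂ) (MCarrier ι) (pderiv ((i, j), w) P) :=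
  pdAway_algebraMap (multiDet ι) ((i, j), w) P

/-- `∂_{ij,w} X_{kl,w′} = δ` in BOTH the place and the entry. [KashiwaraVergne1978, §II.5] -/
theorem dM_uM (w w' : ι) (i j k l : Fin 2) : dM ι w i j (uM ι w' k l) = if w' = w ∧ k = i ∧ l = j then 1 else 0 := by
  rw [uM_apply, dM, pdAway_X]
  by_cases h : w' = w ∧ k = i ∧ l = j
  · obtain ⟨rfl, rfl, rfl⟩ := h
    simp
  · rw [if_neg h, if_neg]
    rintro hkl
    exact h ⟨(Prod.mk.inj hkl).2, (Prod.mk.inj (Prod.mk.inj hkl).1).1, (Prod.mk.inj (Prod.mk.inj hkl).1).2⟩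

/-- **SAME PLACE**: `∂_{ij,w} u_{kl,w} = δ_{(i,j),(k,l)}` — ★ DEFS's interface law `hd` at the place `w`. [LeeZhu1998, §5] -/
theorem dM_uM_same (w : ι) (i j k l : Fin 2) : dM ι w i j (uM ι w k l) = if i = k ∧ j = l then 1 else 0 := by
  rw [dM_uM]
  by_cases h : i = k ∧ j = l
  · obtain ⟨rfl, rfl⟩ := h
    simp
  · rw [if_neg h, if_neg]
    rintro ⟨-, hk, hl⟩
    exact h ⟨hk.symm, hl.symm⟩

/-- **CROSS-PLACE VANISHING**: `∂_{ij,w} u_{kl,w′} = 0` for `w ≠ w′`. [folklore] -/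
theorem dM_uM_of_ne {w w' : ι} (h : w ≠ w') (i j k l : Fin 2) : dM ι w i j (uM ι w' k l) = 0 := by
  rw [dM_uM, if_neg]
  rintro ⟨hw, -, -⟩
  exact h hw.symm

/-- `∂_{ij,w} det(u_{w′}) = 0` for `w ≠ w′`. [folklore] -/
theorem dM_det_uM_of_ne {w w' : ι} (h : w ≠ w') (i j : Fin 2) : dM ι w i j (uM ι w').det = 0 := by
  rw [Matrix.det_fin_two, map_sub, Derivation.leibniz, Derivation.leibniz, dM_uM_of_ne ι h, dM_uM_of_ne ι h, dM_uM_of_ne ι h, dM_uM_of_ne ι h]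
  simp

/-- **CROSS-PLACE VANISHING FOR `D⁻¹`**: `∂_{ij,w} D_{w′}⁻¹ = 0` for `w ≠ w′` (Leibniz on `det(u_{w′}) · D_{w′}⁻¹ = 1`). [folklore] -/
theorem dM_DinvM_of_ne {w w' : ι} (h : w ≠ w') (i j : Fin 2) : dM ι w i j (DinvM ι w') = 0 := by
  have h1 := congrArg (dM ι w i j) (det_uM_mul_DinvM ι w')
  rw [Derivation.leibniz, Derivation.map_one_eq_zero, dM_det_uM_of_ne ι h, smul_zero, add_zero, smul_eq_mul] at h1
  calc dM ι w i j (DinvM ι w') = DinvM ι w' * ((uM ι w').det * dM ι w i j (DinvM ι w')) := by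
        rw [← mul_assoc, mul_comm (DinvM ι w'), det_uM_mul_DinvM, one_mul]
    _ = 0 := by rw [h1, mul_zero]

/-- **SAME PLACE**: `∂_{ij,w} D_w⁻¹ = −D_w⁻² · ∂_{ij,w} det(u_w)` — the shape of ★ DEFS `pd_dInv`. [folklore] -/
theorem dM_DinvM_same (w : ι) (i j : Fin 2) : dM ι w i j (DinvM ι w) = -(DinvM ι w * DinvM ι w) * dM ι w i j (uM ι w).det := by
  have h := congrArg (dM ι w i j) (det_uM_mul_DinvM ι w)
  rw [Derivation.leibniz, Derivation.map_one_eq_zero, smul_eq_mul, smul_eq_mul] at h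
  have h2 : dM ι w i j (DinvM ι w) = DinvM ι w * ((uM ι w).det * dM ι w i j (DinvM ι w)) := by
    rw [← mul_assoc, mul_comm (DinvM ι w), det_uM_mul_DinvM, one_mul]
  rw [h2, eq_neg_of_add_eq_zero_left h]
  ring

end Dec

/-! ## §3  Point evaluations -/

omit [Fintype ι] in
/-- The evaluation point of `v : ι → M₂(ℂ)`: `X_{ij,w} ↦ (v w) i j`. [folklore] -/
theorem aeval_detPolyAt (v : ι → Matrix (Fin 2) (Fin 2) ℂ) (w : ι) :
    MvPolynomial.aeval (fun s : (Fin 2 × Fin 2) × ι => v s.2 s.1.1 s.1.2) (detPolyAt ι w) = (v w).det := by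
  rw [Matrix.det_fin_two]
  simp [detPolyAt]

/-- `(∏_w det_w)(v) = ∏_w det(v w)`. [folklore] -/
theorem aeval_multiDet (v : ι → Matrix (Fin 2) (Fin 2) ℂ) :
    MvPolynomial.aeval (fun s : (Fin 2 × Fin 2) × ι => v s.2 s.1.1 s.1.2) (multiDet ι) = ∏ w, (v w).det := by
  rw [multiDet, map_prod]
  exact Finset.prod_congr rfl fun w _ => aeval_detPolyAt ι v w

/-- `(∏_w det_w)(v) ≠ 0` at a point with invertible components. [folklore] -/
theorem aeval_multiDet_ne_zero (v : ι → Matrix (Fin 2) (Fin 2) ℂ) (hv : ∀ w, (v w).det ≠ 0) :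
    MvPolynomial.aeval (fun s : (Fin 2 × Fin 2) × ι => v s.2 s.1.1 s.1.2) (multiDet ι) ≠ 0 := by
  rw [aeval_multiDet]
  exact Finset.prod_ne_zero_iff.2 fun w _ => hv w

/-- **EVALUATION `ev_v : MCarrier ι →ₐ[ℂ] ℂ` at `v : ι → GL₂(ℂ)`** (as an algebra hom — so `ev_v (∏_w φ_w a_w) = ∏_w ev_v (φ_w a_w)` is `map_prod`). [LeeZhu1998, §5] -/
def evM (v : ι → Matrix (Fin 2) (Fin 2) ℂ) (hv : ∀ w, (v w).det ≠ 0) : MCarrier ι →ₐ[ℂ] ℂ :=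
  evalAway (multiDet ι) (fun s : (Fin 2 × Fin 2) × ι => v s.2 s.1.1 s.1.2) (aeval_multiDet_ne_zero ι v hv)

/-- Evaluation on the image of a polynomial. [folklore] -/
theorem evM_algebraMap (v : ι → Matrix (Fin 2) (Fin 2) ℂ) (hv : ∀ w, (v w).det ≠ 0) (P : MvPolynomial ((Fin 2 × Fin 2) × ι) ℂ) :
    evM ι v hv (algebraMap (MvPolynomial ((Fin 2 × Fin 2) × ι) ℂ) (MCarrier ι) P) =
      MvPolynomial.aeval (fun s : (Fin 2 × Fin 2) × ι => v s.2 s.1.1 s.1.2) P :=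
  evalAway_algebraMap (multiDet ι) _ (aeval_multiDet_ne_zero ι v hv) P

/-- **`ev_v (u_{ij,w}) = (v w)_{ij}`**. [LeeZhu1998, §5] -/
theorem evM_uM (v : ι → Matrix (Fin 2) (Fin 2) ℂ) (hv : ∀ w, (v w).det ≠ 0) (w : ι) (i j : Fin 2) : evM ι v hv (uM ι w i j) = v w i j := by
  rw [uM_apply, evM_algebraMap, MvPolynomial.aeval_X]

/-- `ev_v (det u_w) = det (v w)`. [folklore] -/
theorem evM_det_uM (v : ι → Matrix (Fin 2) (Fin 2) ℂ) (hv : ∀ w, (v w).det ≠ 0) (w : ι) : evM ι v hv (uM ι w).det = (v w).det := by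
  rw [det_uM, evM_algebraMap, aeval_detPolyAt]

/-- **`ev_v (D_w⁻¹) = det(v w)⁻¹`**. [LeeZhu1998, §5] -/
theorem evM_DinvM [DecidableEq ι] (v : ι → Matrix (Fin 2) (Fin 2) ℂ) (hv : ∀ w, (v w).det ≠ 0) (w : ι) : evM ι v hv (DinvM ι w) = ((v w).det)⁻¹ := by
  have h := congrArg (evM ι v hv) (det_uM_mul_DinvM ι w)
  rw [map_mul, map_one, evM_det_uM] at h
  exact eq_inv_of_mul_eq_one_right h

/-- Evaluation of a product over the places (pure tensor) is the product of the evaluations. [folklore] -/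
theorem evM_prod (v : ι → Matrix (Fin 2) (Fin 2) ℂ) (hv : ∀ w, (v w).det ≠ 0) (x : ι → MCarrier ι) :
    evM ι v hv (∏ w, x w) = ∏ w, evM ι v hv (x w) :=
  map_prod (evM ι v hv) x Finset.univ

end Summit.HodgeConjecture.HodgeConjecture.Cruxes.HLiu418.K2LiuU22MultiPlaceCarrierDefs

end
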